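import Summits.CriticalPhenomena.PercolationContinuityZ3.Theorems.PercNearOneGluingNoHeavyPcintOSMRenewal
import HarnessLib

/-!
# PCINT lane, PHASE 4 (kernel second-moment oriented route), step 2: counting words by letter content

Cell `prim-pcint`, seat `prim-pcint-1` (gen 13); memo `run/shared/lean/prim/pcint/T-FIBRE-ROUTE.md` §PHASE 4.

The pair count `OSM.cnt d k 0` (pairs of words of length `k` over `Fin d` ending at the same vertex, i.e. with the same
letter content) is brought to a KERNEL-COMPUTABLE form:

* `cv w` = the letter-content vector of `w`; `nW k c` = the number of words of length `k` with content `c`;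
* `nW_eq` : `nW k c = k! / ∏ (c j)!` (first-letter recursion `nW_succ`);
* `cnt_zero_eq` : `cnt d k 0 = Σ_{c ∈ piAntidiag univ k} (nW k c)²`;
* `T s k = Σ_{c ∈ piAntidiag s k} (k!/∏_{j∈s} c_j!)²` satisfies the letter-peeling recursion
  `T (cons a s) k = Σ_{j ≤ k} C(k,j)² T s (k-j)` (`T_cons`), whence `T univ k = Mrec d k` for the explicit recursion
  `Mrec` (`T_eq_Mrec`) and **`OSM.u d k = Mrec d k / d^{2k}`** (`u_eq_Mrec`).
-/

noncomputable section

namespace Summit.CriticalPhenomena.PercolationContinuityZ3.Theorems.Pcint.OSM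

open Finset Nat

variable {d : ℕ}

/-! ### Letter contents -/

/-- **Letter content** of a word: `cv w j` = the number of letters `j` in `w`. -/
def cv {k : ℕ} (w : Fin k → Fin d) : Fin d → ℕ := fun j => ∑ t : Fin k, if w t = j then 1 else 0

/-- The final position of the walk is its letter content. -/
theorem pos_self {k : ℕ} (w : Fin k → Fin d) : pos w k = fun j => (cv w j : ℤ) := by
  funext j
  simp only [pos, cv, Fin.is_lt, true_and, Nat.cast_sum, Nat.cast_ite, Nat.cast_one, Nat.cast_zero]

/-- Two walks of `k` steps end together iff their words have the same content. -/
theorem pos_self_eq_iff {k : ℕ} (w w' : Fin k → Fin d) : pos w k = pos w' k ↔ cv w = cv w' := by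
  rw [pos_self, pos_self]
  constructor
  · intro h; funext j; exact_mod_cast congr_fun h j
  · intro h; rw [h]

/-- The content vector sums to the length. -/
theorem sum_cv {k : ℕ} (w : Fin k → Fin d) : ∑ j, cv w j = k := by
  unfold cv
  rw [Finset.sum_comm]
  simp

/-- Content vectors lie in `piAntidiag univ k`. -/
theorem cv_mem {k : ℕ} (w : Fin k → Fin d) : cv w ∈ (univ : Finset (Fin d)).piAntidiag k := by
  rw [mem_piAntidiag]
  exact ⟨sum_cv w, fun _ _ => mem_univ _⟩

/-- Content of the empty word. -/
theorem cv_zero (w : Fin 0 → Fin d) : cv w = 0 := by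
  funext j; simp [cv]

/-- First-letter recursion of the content. -/
theorem cv_cons {k : ℕ} (a : Fin d) (w : Fin k → Fin d) :
    cv (Fin.cons a w : Fin (k + 1) → Fin d) = cv w + Pi.single a 1 := by
  funext j
  simp only [cv, Fin.sum_univ_succ, Fin.cons_zero, Fin.cons_succ, Pi.add_apply, Pi.single_apply]
  by_cases h : a = j
  · subst h; simp [add_comm]
  · rw [if_neg h, if_neg (Ne.symm h)]; simp

/-- **`nW k c`** = the number of words of length `k` over `Fin d` with letter content `c`. -/
def nW (d k : ℕ) (c : Fin d → ℕ) : ℕ := (univ.filter fun w : Fin k → Fin d => cv w = c).card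

/-- `nW` as a sum of indicators. -/
theorem nW_eq_sum (k : ℕ) (c : Fin d → ℕ) : (nW d k c : ℝ) = ∑ w : Fin k → Fin d, if cv w = c then (1 : ℝ) else 0 := by
  rw [nW, Finset.card_filter]; push_cast; rfl

/-- The empty word. -/
theorem nW_zero (c : Fin d → ℕ) : nW d 0 c = if c = 0 then 1 else 0 := by
  unfold nW
  by_cases hc : c = 0
  · rw [if_pos hc]
    rw [Finset.card_eq_one]
    refine ⟨Fin.elim0, ?_⟩
    ext w
    simp only [mem_filter, mem_univ, true_and, mem_singleton, cv_zero, hc, true_iff]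
    funext i; exact Fin.elim0 i
  · rw [if_neg hc, Finset.card_eq_zero, Finset.filter_eq_empty_iff]
    intro w _ h
    exact hc (by rw [← h, cv_zero])

/-- `x + e_a = c` iff `c a ≥ 1` and `x = c − e_a` (pointwise natural subtraction). -/
theorem add_single_eq_iff (x c : Fin d → ℕ) (a : Fin d) :
    x + Pi.single a 1 = c ↔ 1 ≤ c a ∧ x = c - Pi.single a 1 := by
  constructor
  · rintro rfl
    refine ⟨by simp, ?_⟩
    funext j; simp [Pi.sub_apply]
  · rintro ⟨ha, rfl⟩
    funext j
    simp only [Pi.add_apply, Pi.sub_apply, Pi.single_apply]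
    by_cases h : j = a
    · subst h; simp; omega
    · simp [h]

/-- **First-letter recursion**: `nW (k+1) c = Σ_a [c a ≥ 1] · nW k (c − e_a)`. -/
theorem nW_succ (k : ℕ) (c : Fin d → ℕ) :
    (nW d (k + 1) c : ℝ) = ∑ a : Fin d, if 1 ≤ c a then (nW d k (c - Pi.single a 1) : ℝ) else 0 := by
  rw [nW_eq_sum, sum_word_succ]
  refine Finset.sum_congr rfl fun a _ => ?_
  simp_rw [cv_cons, add_single_eq_iff]
  by_cases ha : 1 ≤ c a
  · simp only [ha, true_and, if_true, nW_eq_sum]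
  · simp only [ha, false_and, if_false, Finset.sum_const_zero]

/-- The sum of a content vector with a letter removed. -/
theorem sum_sub_single {c : Fin d → ℕ} {a : Fin d} (ha : 1 ≤ c a) :
    ∑ j, (c - Pi.single a 1 : Fin d → ℕ) j + 1 = ∑ j, c j := by
  have h : c = (c - Pi.single a 1) + Pi.single a 1 := by
    funext j
    simp only [Pi.add_apply, Pi.sub_apply, Pi.single_apply]
    by_cases hj : j = a
    · subst hj; simp; omega
    · simp [hj]
  conv_rhs => rw [h]
  simp only [Pi.add_apply, Finset.sum_add_distrib, Pi.single_apply, Finset.sum_ite_eq', Finset.mem_univ,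
    if_true]

/-- The factorial product of a content vector with a letter removed. -/
theorem prod_factorial_sub_single {c : Fin d → ℕ} {a : Fin d} (ha : 1 ≤ c a) :
    (∏ j, (((c - Pi.single a 1 : Fin d → ℕ) j)! : ℝ)) * (c a : ℝ) = ∏ j, ((c j)! : ℝ) := by
  rw [← Finset.mul_prod_erase univ _ (mem_univ a), ← Finset.mul_prod_erase univ (fun j => ((c j)! : ℝ)) (mem_univ a)]
  have h1 : ∏ j ∈ univ.erase a, (((c - Pi.single a 1 : Fin d → ℕ) j)! : ℝ) = ∏ j ∈ univ.erase a, ((c j)! : ℝ) := by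
    refine Finset.prod_congr rfl fun j hj => ?_
    have hja : j ≠ a := (mem_erase.1 hj).1
    simp [Pi.sub_apply, hja]
  rw [h1]
  have h2 : (((c - Pi.single a 1 : Fin d → ℕ) a)! : ℝ) * (c a : ℝ) = ((c a)! : ℝ) := by
    simp only [Pi.sub_apply, Pi.single_eq_same]
    obtain ⟨m, hm⟩ : ∃ m, c a = m + 1 := ⟨c a - 1, by omega⟩
    rw [hm, Nat.add_sub_cancel, Nat.factorial_succ]; push_cast; ring
  rw [← h2]; ring

/-- **The number of words with a given content**: `nW k c = k! / ∏ (c j)!`. -/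
theorem nW_eq : ∀ (k : ℕ) (c : Fin d → ℕ), ∑ j, c j = k →
    (nW d k c : ℝ) = (k ! : ℝ) / ∏ j, ((c j)! : ℝ)
  | 0, c, hc => by
    have h0 : c = 0 := by
      funext j
      have := (Finset.sum_eq_zero_iff.1 hc) j (mem_univ j)
      simpa using this
    subst h0
    simp [nW_zero]
  | k + 1, c, hc => by
    rw [nW_succ]
    have hterm : ∀ a : Fin d, (if 1 ≤ c a then (nW d k (c - Pi.single a 1) : ℝ) else 0) =
        (k ! : ℝ) * (c a : ℝ) / ∏ j, ((c j)! : ℝ) := by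
      intro a
      by_cases ha : 1 ≤ c a
      · rw [if_pos ha, nW_eq k (c - Pi.single a 1) (by have := sum_sub_single ha; omega),
          ← prod_factorial_sub_single ha]
        have hpos : (0 : ℝ) < ∏ j, (((c - Pi.single a 1 : Fin d → ℕ) j)! : ℝ) :=
          Finset.prod_pos fun j _ => by exact_mod_cast Nat.factorial_pos _
        have hca : (0 : ℝ) < (c a : ℝ) := by exact_mod_cast ha
        field_simp
      · rw [if_neg ha]
        have : c a = 0 := by omega
        rw [this]; simp
    simp_rw [hterm]
    rw [← Finset.sum_div, ← Finset.mul_sum]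
    congr 1
    rw [Nat.factorial_succ, Nat.cast_mul, ← hc, Nat.cast_sum]; ring

/-! ### The pair count as a sum of squares -/

/-- **`cnt d k 0 = Σ_c (nW k c)²`** over content vectors. -/
theorem cnt_zero_eq (k : ℕ) :
    cnt d k 0 = ∑ c ∈ (univ : Finset (Fin d)).piAntidiag k, ((nW d k c : ℝ)) ^ 2 := by
  unfold cnt
  simp_rw [zero_add, pos_self_eq_iff]
  have h1 : ∀ w : Fin k → Fin d, (∑ w' : Fin k → Fin d, if cv w = cv w' then (1 : ℝ) else 0) = nW d k (cv w) := by
    intro w; rw [nW_eq_sum]; refine Finset.sum_congr rfl fun w' _ => ?_; simp only [eq_comm]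
  simp_rw [h1]
  rw [← Finset.sum_fiberwise_of_maps_to' (g := cv) (fun w _ => cv_mem w) (fun c => (nW d k c : ℝ))]
  refine Finset.sum_congr rfl fun c _ => ?_
  rw [Finset.sum_const, nsmul_eq_mul, sq]
  rfl

/-- **`cnt d k 0 = Σ_{c} (k!/∏ c_j!)²`.** -/
theorem cnt_zero_eq_factorial (k : ℕ) :
    cnt d k 0 = ∑ c ∈ (univ : Finset (Fin d)).piAntidiag k, ((k ! : ℝ) / ∏ j, ((c j)! : ℝ)) ^ 2 := by
  rw [cnt_zero_eq]
  refine Finset.sum_congr rfl fun c hc => ?_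
  rw [nW_eq k c (mem_piAntidiag.1 hc).1]

/-! ### Peeling letters: the computable recursion -/

/-- The factorial-form sum over content vectors supported in `s`. -/
def T (s : Finset (Fin d)) (k : ℕ) : ℝ :=
  ∑ c ∈ s.piAntidiag k, ((k ! : ℝ) / ∏ j ∈ s, ((c j)! : ℝ)) ^ 2

/-- **The explicit recursion** (alphabet size `i`, length `k`): `Mrec 0 k = [k = 0]`,
`Mrec (i+1) k = Σ_{j ≤ k} C(k,j)² · Mrec i (k − j)`. -/
def Mrec : ℕ → ℕ → ℕ
  | 0, k => if k = 0 then 1 else 0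
  | i + 1, k => ∑ j ∈ range (k + 1), k.choose j ^ 2 * Mrec i (k - j)

/-- No letters: only the empty word. -/
theorem T_empty (k : ℕ) : T (∅ : Finset (Fin d)) k = if k = 0 then 1 else 0 := by
  unfold T
  rw [piAntidiag_empty]
  split_ifs with hk
  · subst hk; simp
  · simp

/-- **Letter peeling**: `T (cons a s) k = Σ_{j ≤ k} C(k,j)² · T s (k − j)`. -/
theorem T_cons {a : Fin d} {s : Finset (Fin d)} (ha : a ∉ s) (k : ℕ) :
    T (cons a s ha) k = ∑ j ∈ range (k + 1), (k.choose j : ℝ) ^ 2 * T s (k - j) := by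
  unfold T
  rw [piAntidiag_cons, Finset.sum_disjiUnion, Finset.Nat.sum_antidiagonal_eq_sum_range_succ_mk]
  refine Finset.sum_congr rfl fun j hj => ?_
  have hjk : j ≤ k := Nat.lt_succ_iff.1 (mem_range.1 hj)
  rw [Finset.sum_map, Finset.mul_sum]
  refine Finset.sum_congr rfl fun g hg => ?_
  have hga : g a = 0 := by
    have := (mem_piAntidiag.1 hg).2 a
    by_contra h
    exact ha (this h)
  simp only [addRightEmbedding_apply, Finset.prod_cons, Pi.add_apply, if_true, hga, zero_add]
  have hprod : ∏ x ∈ s, (((g x + if x = a then j else 0))! : ℝ) = ∏ x ∈ s, ((g x)! : ℝ) := by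
    refine Finset.prod_congr rfl fun x hx => ?_
    have : x ≠ a := fun h => ha (h ▸ hx)
    rw [if_neg this, add_zero]
  rw [hprod]
  have hchoose : (k.choose j : ℝ) = (k ! : ℝ) / ((j ! : ℝ) * ((k - j)! : ℝ)) := by
    have h := Nat.choose_mul_factorial_mul_factorial hjk
    rw [eq_div_iff (by positivity), ← mul_assoc]
    exact_mod_cast h
  rw [hchoose]
  have hj0 : (0 : ℝ) < (j ! : ℝ) := by exact_mod_cast Nat.factorial_pos _
  have hkj0 : (0 : ℝ) < ((k - j)! : ℝ) := by exact_mod_cast Nat.factorial_pos _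
  have hP : (0 : ℝ) < ∏ x ∈ s, ((g x)! : ℝ) := Finset.prod_pos fun _ _ => by exact_mod_cast Nat.factorial_pos _
  field_simp

/-- **`T s k = Mrec s.card k`**: the factorial-form sum is the explicit recursion. -/
theorem T_eq_Mrec : ∀ (s : Finset (Fin d)) (k : ℕ), T s k = (Mrec s.card k : ℝ) := by
  intro s
  induction s using Finset.cons_induction with
  | empty => intro k; rw [T_empty, card_empty, Mrec]; split_ifs <;> simp
  | cons a s ha ih =>
    intro k
    rw [T_cons ha, card_cons, Mrec]
    push_cast
    refine Finset.sum_congr rfl fun j _ => ?_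
    rw [ih]

/-- **The kernel form of `u`**: `u d k = Mrec d k / d^{2k}`. -/
theorem u_eq_Mrec (k : ℕ) : u d k = (Mrec d k : ℝ) / (d : ℝ) ^ (2 * k) := by
  unfold u
  rw [cnt_zero_eq_factorial]
  have : cnt d k 0 = T (univ : Finset (Fin d)) k := by rw [cnt_zero_eq_factorial]; rfl
  rw [← cnt_zero_eq_factorial, this, T_eq_Mrec, Finset.card_univ, Fintype.card_fin]

end Summit.CriticalPhenomena.PercolationContinuityZ3.Theorems.Pcint.OSM

end
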